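import Summits.ResolutionOfSingularities.ResolutionOfSingularities.Theorems.WeightedInvariantIota3IsoSuccGradedLowest
import Literature.RingTheory.MvPolynomial.NoetherFormsBertini
import Literature.AlgebraicGeometry.Resolution.WeightedCentreEndomorphismLayers
import HarnessLib

/-!
# (iso-succ) PART A″ — the weighted initial form has order `< ν` along every CURVE of the exceptional divisor unless it is a pure power
# `c·(ℓ + φ)^ν` (door `HypersurfaceCentreConstruction`, stmt-ResolutionOfSingularities-19897; stub `stub_keyRungGrHomLE_three`, residual
# (D-b³-point-STAT) of …KeyRungThreeOfDropPointStat; (o42) PART C programme of res-type-073, graded half)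

Topic: `Summits/ResolutionOfSingularities/ResolutionOfSingularities/Theorems`.  DEF-FREE.  Helper `--supports stmt-ResolutionOfSingularities-19897`.

After hand -11 (…KeyRungThreeOfDropPointStat, p837988) the gap list of `stub_keyRungGrHomLE_three` is hD + (D-b³-point-STAT): the `ι₃ᵗ`-drop at
the ORDER-STATIONARY `t`-homogeneous successors of the cobordant blow-up of a closed-point centre.  Hand -11's question to the disprover was whether,
at an ISOLATED start, such a successor can have the letter `ε = 1` (equimultiple locus through the successor = a curve or two crossing curves of the
exceptional divisor), which would RAISE `ι₀ = (ν ; ε ; τ)`.  Modulo `t⁻¹` the saturated transform is the weighted initial form `F = in_w f` in the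
weighted polynomial ring `κ[X₀, X₁, X₂] = B ⧸ (t⁻¹)` (`LocalGameEFTPointMove.rho`), and a curve of the exceptional divisor through the successor along
which the order stays `ν` is a HEIGHT-ONE prime `𝔭` of `κ[X]` with `F ∈ 𝔭^ν κ[X]_𝔭`.  This file proves the graded statement that closes that door:

* `Iota3.isWeightedHomogeneous_of_dvd` — a divisor of a non-zero weighted-homogeneous polynomial (positive `ℕ`-weights, over a field) is
  weighted-homogeneous (transfer of `MvPolynomial.IsWeightedHomogeneous.exists_of_mul_left`, `ℤ`-weights, Literature NoetherFormsBertini, along the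
  cast bookkeeping `weight_intCast` of Literature WeightedCentreEndomorphismLayers).
* `Iota3.pow_dvd_of_mem_pow_localization_heightOne` — `κ[X]` is factorial: a height-one prime is `(G)` with `G` prime, and
  `F ∈ 𝔪_{κ[X]_𝔭}^ν` forces `G ^ ν ∣ F`.
* **`Iota3.eq_C_mul_pow_of_mem_pow_atPrime_heightOne`** — with `F` weighted-homogeneous of degree `r₁ν` for the weights `(q, r₂, r₁)`
  (`0 < q ≤ r₂ ≤ r₁`, `0 < ν`) carrying a monomial of standard degree `ν` (the shape of `in_w f` for `f ∉ 𝔪^{ν+1}`, (BR3)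
  `exists_coeff_faceSum_ne_zero_of_degree_eq_fin3`), and `𝔭 ≠ 0` a prime of height `≤ 1` with `F ∈ 𝔪_{κ[X]_𝔭}^ν`:
  `F = c·(ℓ + φ)^ν`, `𝔭 = (ℓ + φ)`, `ℓ ≠ 0` LINEAR in the variables of top weight `r₁`, `φ` of standard order `≥ 2`, both of weight `r₁` — i.e.
  PART A′ (`eq_C_mul_pow_of_pow_dvd_of_le_fin3`, p-landed) applies; its conclusion is what PART B′ (`IsSigmaMaximiser.not_sub_pow_mem_succ_level_reflag`)
  contradicts at a σ-maximiser presentation.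
* `Iota3.height_le_one_of_lt_of_lt` — the height bookkeeping the B-side consumer has in hand: a chain of primes `𝔭 < 𝔭₁ < 𝔭₂` in `κ[X₀,X₁,X₂]`
  (`𝔭₁ = ρ(𝔫)` the successor, `𝔭₂ = (X₀, X₁, X₂) = ρ(vertex + (t⁻¹))`) gives `height 𝔭 ≤ 1`.

CONSEQUENCE (for the next hand; not typed here): at an ISOLATED σ-maximal start NO prime `𝔮 ∋ t⁻¹` strictly inside a `t`-homogeneous successor
`𝔫` is order-stationary; together with …IotaOrderOffExceptional (primes `∌ t⁻¹`) the equimultiple locus of the transform at an order-stationary `𝔫`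
is the closed point: `ε = τ = 0` there, the successor is again ISOLATED, and (D-b³-point-STAT) in the isolated regime is EXACTLY the `σ`-comparison.

[OURS · L1 W4.3 · folklore commutative algebra for OUR (o42)/(D-b³-point) bookkeeping; AI work, weaker than expert review; nothing here is a statement
of the manuscript under review (Hironaka 2017, [claim: Hironaka2017, status: under-review]).]

## References

* H. Matsumura, *Commutative Ring Theory*, CUP 1986, Thm. 20.1/20.3 (factorial rings, height-one primes principal). [Matsumura1987]
* D. Abramovich, M. Temkin, J. Włodarczyk, *Functorial embedded resolution via weighted blowings up*, Algebra & Number Theory 18 (2024), §5. [AbramovichTemkinWlodarczyk2024]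
-/

open MvPolynomial IsLocalRing
open Literature.AlgebraicGeometry.Resolution.WeightedBlowup.EndomorphismLayers (weight_intCast isWeightedHomogeneous_intCast_iff)

set_option linter.dupNamespace false -- mandated namespace of this single-conjunct summit

namespace Summit.ResolutionOfSingularities.ResolutionOfSingularities.Cruxes.HypersurfaceCentreConstruction.LocalEngine

namespace Iota3

section Homogeneity

variable {k : Type} [Field k] {σ : Type}

/-- **A divisor of a non-zero weighted-homogeneous polynomial is weighted-homogeneous** (`ℕ`-weights, over a field; transfer of the
`ℤ`-weighted `MvPolynomial.IsWeightedHomogeneous.exists_of_mul_left`). [folklore] -/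
theorem isWeightedHomogeneous_of_dvd (w : σ → ℕ) {F G : MvPolynomial σ k} {n : ℕ} (hF : F.IsWeightedHomogeneous w n) (hF0 : F ≠ 0)
    (hGF : G ∣ F) : ∃ d : ℕ, G.IsWeightedHomogeneous w d := by
  obtain ⟨H, rfl⟩ := hGF
  have hH0 : H ≠ 0 := by rintro rfl; exact hF0 (mul_zero G)
  have hF' : (G * H).IsWeightedHomogeneous (fun i => (w i : ℤ)) (n : ℤ) := (isWeightedHomogeneous_intCast_iff w _ n).mpr hF
  obtain ⟨a, ha⟩ := MvPolynomial.IsWeightedHomogeneous.exists_of_mul_left hF' hH0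
  refine ⟨a.toNat, fun m hm => ?_⟩
  have h1 : Finsupp.weight (fun i => (w i : ℤ)) m = a := ha hm
  rw [weight_intCast] at h1
  have h2 : (0 : ℤ) ≤ a := by rw [← h1]; exact_mod_cast Nat.zero_le _
  have h3 : ((Finsupp.weight w m : ℕ) : ℤ) = (a.toNat : ℤ) := by rw [h1, Int.toNat_of_nonneg h2]
  exact_mod_cast h3

/-- With positive weights, a weighted-homogeneous polynomial of degree `0` is a constant. [folklore] -/
theorem eq_C_of_isWeightedHomogeneous_zero (w : σ → ℕ) (hw : ∀ j, 0 < w j) {G : MvPolynomial σ k} (hG : G.IsWeightedHomogeneous w 0) :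
    G = C (G.coeff 0) := by
  classical
  ext m
  rw [coeff_C]
  split_ifs with hm
  · rw [← hm]
  · by_contra hc
    have h0 : Finsupp.weight w m = 0 := hG hc
    have hm' : m ≠ 0 := fun h => hm h.symm
    exact (weight_pos_of_ne_zero w hw hm').ne' h0

/-- A non-zero non-unit weighted-homogeneous polynomial (positive weights) has POSITIVE degree. [folklore] -/
theorem pos_of_isWeightedHomogeneous_of_not_isUnit (w : σ → ℕ) (hw : ∀ j, 0 < w j) {G : MvPolynomial σ k} {d : ℕ}
    (hG : G.IsWeightedHomogeneous w d) (hG0 : G ≠ 0) (hGu : ¬ IsUnit G) : 0 < d := by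
  by_contra hd
  have hd0 : d = 0 := by omega
  subst hd0
  have hGC := eq_C_of_isWeightedHomogeneous_zero w hw hG
  have hc0 : G.coeff 0 ≠ 0 := by
    intro h
    rw [h, C_0] at hGC
    exact hG0 hGC
  exact hGu (hGC ▸ (isUnit_iff_ne_zero.mpr hc0).map C)

end Homogeneity

/-! ## Height-one primes of `κ[X]` and the order along them -/

section HeightOne

variable {k : Type} [Field k] {σ : Type}

/-- **Height-one primes of `κ[X]` are principal and `F ∈ 𝔪_{κ[X]_𝔭}^ν` means `G ^ ν ∣ F`** for a generator `G` (`κ[X]` is factorial).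
[cite: Matsumura1987, Thm. 20.1] (folklore rendering) -/
theorem pow_dvd_of_mem_pow_localization_heightOne {F : MvPolynomial σ k} (𝔭 : Ideal (MvPolynomial σ k)) [𝔭.IsPrime] (h𝔭0 : 𝔭 ≠ ⊥)
    (h𝔭1 : 𝔭.height ≤ 1) {ν : ℕ}
    (hmem : algebraMap (MvPolynomial σ k) (Localization.AtPrime 𝔭) F ∈ maximalIdeal (Localization.AtPrime 𝔭) ^ ν) :
    ∃ G : MvPolynomial σ k, Prime G ∧ 𝔭 = Ideal.span {G} ∧ G ^ ν ∣ F := by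
  -- a prime element in `𝔭` generates it
  obtain ⟨G, hG𝔭, hG⟩ := Ideal.IsPrime.exists_mem_prime_of_ne_bot ‹𝔭.IsPrime› h𝔭0
  have hht : 𝔭.height = 1 := by
    refine le_antisymm h𝔭1 ?_
    rw [Order.one_le_iff_ne_zero, Ne, Ideal.height_eq_zero_iff_eq_bot]
    exact h𝔭0
  have h𝔭G : 𝔭 = Ideal.span {G} := Ideal.eq_span_singleton_of_height_eq_one hht hG𝔭 hG
  refine ⟨G, hG, h𝔭G, ?_⟩
  -- `F ∈ 𝔭^ν κ[X]_𝔭 = (span {G ^ ν}).map _`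
  have hpow : 𝔭 ^ ν = Ideal.span {G ^ ν} := by rw [h𝔭G, Ideal.span_singleton_pow]
  have hmap : maximalIdeal (Localization.AtPrime 𝔭) ^ ν = (Ideal.span {G ^ ν}).map (algebraMap _ (Localization.AtPrime 𝔭)) := by
    rw [← Localization.AtPrime.map_eq_maximalIdeal, ← Ideal.map_pow, hpow]
  rw [hmap, IsLocalization.mem_map_algebraMap_iff 𝔭.primeCompl] at hmem
  obtain ⟨⟨⟨a, ha⟩, ⟨s, hs⟩⟩, h⟩ := hmem
  simp only at h
  rw [← map_mul] at h
  have hinj : Function.Injective (algebraMap (MvPolynomial σ k) (Localization.AtPrime 𝔭)) :=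
    IsLocalization.injective (Localization.AtPrime 𝔭) 𝔭.primeCompl_le_nonZeroDivisors
  have hFs : F * s = a := hinj h
  obtain ⟨b, hb⟩ := Ideal.mem_span_singleton'.mp ha
  have hdvd : G ^ ν ∣ F * s := ⟨b, by rw [hFs, ← hb, mul_comm]⟩
  have hsG : ¬ G ∣ s := by
    intro hGs
    apply hs
    rw [h𝔭G]
    exact Ideal.mem_span_singleton.mpr hGs
  exact hG.pow_dvd_of_dvd_mul_right ν hsG hdvd

/-- **Height bookkeeping for the consumer**: a chain of primes `𝔭 < 𝔭₁ < 𝔭₂` in `κ[X₀, …, X_{m-1}]` with `m ≤ 3` forces `height 𝔭 ≤ 1`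
(`dim κ[X] = m`). [folklore] -/
theorem height_le_one_of_lt_of_lt {m : ℕ} (hm : m ≤ 3) {𝔭 𝔭₁ 𝔭₂ : Ideal (MvPolynomial (Fin m) k)} [𝔭.IsPrime] [𝔭₁.IsPrime] [𝔭₂.IsPrime]
    (h₁ : 𝔭 < 𝔭₁) (h₂ : 𝔭₁ < 𝔭₂) : 𝔭.height ≤ 1 := by
  have hdim : ringKrullDim (MvPolynomial (Fin m) k) = (m : WithBot ℕ∞) := by
    rw [MvPolynomial.ringKrullDim_of_isNoetherianRing, ringKrullDim_eq_zero_of_field, zero_add, Nat.card_eq_fintype_card, Fintype.card_fin]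
  have h2 : 𝔭₂.height ≤ 3 := by
    have := Ideal.height_le_ringKrullDim_of_isPrime (I := 𝔭₂)
    have h4 : (𝔭₂.height : WithBot ℕ∞) ≤ ((m : ℕ∞) : WithBot ℕ∞) := by
      rw [WithBot.coe_natCast, ← hdim]; exact this
    have h5 : 𝔭₂.height ≤ (m : ℕ∞) := WithBot.coe_le_coe.mp h4
    exact h5.trans (by exact_mod_cast hm)
  have ha := Ideal.height_add_one_le_of_lt_of_isPrime h₁
  have hb := Ideal.height_add_one_le_of_lt_of_isPrime h₂
  have hfin : 𝔭₂.height ≠ ⊤ := by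
    intro h; rw [h] at h2; exact absurd h2 (by decide)
  -- arithmetic in `ℕ∞`
  obtain ⟨c, hc⟩ := ENat.ne_top_iff_exists.mp hfin
  rw [← hc] at h2 hb
  have hb' : 𝔭₁.height ≠ ⊤ := by
    intro h; rw [h] at hb; exact absurd hb (by simp)
  obtain ⟨b, hbb⟩ := ENat.ne_top_iff_exists.mp hb'
  rw [← hbb] at ha hb
  have ha' : 𝔭.height ≠ ⊤ := by
    intro h; rw [h] at ha; exact absurd ha (by simp)
  obtain ⟨a, haa⟩ := ENat.ne_top_iff_exists.mp ha'
  rw [← haa] at ha ⊢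
  have e1 : a + 1 ≤ b := by exact_mod_cast ha
  have e2 : b + 1 ≤ c := by exact_mod_cast hb
  have e3 : c ≤ 3 := by exact_mod_cast h2
  exact_mod_cast (show a ≤ 1 by omega)

end HeightOne

/-! ## The pure-power form along an order-stationary curve -/

section Assembly

variable {k : Type} [Field k]

/-- **(iso-succ) PART A″.**  Weights `(q, r₂, r₁)` with `0 < q ≤ r₂ ≤ r₁`, `0 < ν`; `F ∈ κ[X₀, X₁, X₂]` weighted-homogeneous of degree `r₁ν`
with a monomial of standard degree `ν`; `𝔭 ≠ 0` a prime of height `≤ 1` (a curve of the weighted plane `B ⧸ (t⁻¹)`) along which `F` has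
order `≥ ν` (`F ∈ 𝔪_{κ[X]_𝔭}^ν`).  Then `F` is the pure power `c·(ℓ + φ)^ν` of the generator `ℓ + φ` of `𝔭`, with `ℓ ≠ 0` a linear form in the
variables of top weight `r₁` and `φ` of standard order `≥ 2`, both of weight `r₁` — the shape PART B′ contradicts at a σ-maximiser.
[folklore commutative algebra · OUR (o42)/(D-b³-point-STAT) bookkeeping] -/
theorem eq_C_mul_pow_of_mem_pow_atPrime_heightOne {q r₂ r₁ ν : ℕ} (hq : 0 < q) (hq₂ : q ≤ r₂) (h₂₁ : r₂ ≤ r₁) (hν : 0 < ν)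
    {F : MvPolynomial (Fin 3) k} (hF : F.IsWeightedHomogeneous ![q, r₂, r₁] (r₁ * ν)) (hFν : ∃ m ∈ F.support, Finsupp.degree m = ν)
    (𝔭 : Ideal (MvPolynomial (Fin 3) k)) [𝔭.IsPrime] (h𝔭0 : 𝔭 ≠ ⊥) (h𝔭1 : 𝔭.height ≤ 1)
    (hmem : algebraMap (MvPolynomial (Fin 3) k) (Localization.AtPrime 𝔭) F ∈ maximalIdeal (Localization.AtPrime 𝔭) ^ ν) :
    ∃ (c : k) (ℓ φ : MvPolynomial (Fin 3) k), c ≠ 0 ∧ ℓ ≠ 0 ∧ F = C c * (ℓ + φ) ^ ν ∧ 𝔭 = Ideal.span {ℓ + φ} ∧ ℓ.IsHomogeneous 1 ∧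
      (∀ j, ℓ.coeff (Finsupp.single j 1) ≠ 0 → (![q, r₂, r₁] : Fin 3 → ℕ) j = r₁) ∧ (∀ m ∈ φ.support, 2 ≤ Finsupp.degree m) ∧
      ℓ.IsWeightedHomogeneous ![q, r₂, r₁] r₁ ∧ φ.IsWeightedHomogeneous ![q, r₂, r₁] r₁ := by
  classical
  obtain ⟨G, hG, h𝔭G, hdvd⟩ := pow_dvd_of_mem_pow_localization_heightOne 𝔭 h𝔭0 h𝔭1 hmem
  have hF0 : F ≠ 0 := by
    obtain ⟨m₀, hm₀, -⟩ := hFν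
    exact ne_zero_iff.mpr ⟨m₀, mem_support_iff.mp hm₀⟩
  have hw : ∀ j : Fin 3, 0 < (![q, r₂, r₁] : Fin 3 → ℕ) j := by
    intro j
    fin_cases j
    · exact hq
    · exact lt_of_lt_of_le hq hq₂
    · exact lt_of_lt_of_le hq (hq₂.trans h₂₁)
  -- `G ∣ F`, so `G` is weighted-homogeneous of positive degree
  have hGF : G ∣ F := (dvd_pow_self G hν.ne').trans hdvd
  obtain ⟨d, hGd⟩ := isWeightedHomogeneous_of_dvd ![q, r₂, r₁] hF hF0 hGF
  have hd : 0 < d := pos_of_isWeightedHomogeneous_of_not_isUnit ![q, r₂, r₁] hw hGd hG.ne_zero hG.not_unit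
  obtain ⟨c, ℓ, φ, hc, hℓ, hFe, hGe, hℓ1, hℓvar, hφ2, hℓw, hφw, -⟩ :=
    eq_C_mul_pow_of_pow_dvd_of_le_fin3 hq hq₂ h₂₁ hν hF hFν hGd hd hdvd
  refine ⟨c, ℓ, φ, hc, hℓ, ?_, ?_, hℓ1, hℓvar, hφ2, hℓw, hφw⟩
  · rw [hFe, hGe]
  · rw [h𝔭G, hGe]

end Assembly

end Iota3

end Summit.ResolutionOfSingularities.ResolutionOfSingularities.Cruxes.HypersurfaceCentreConstruction.LocalEngine
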